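import Literature.NumberTheory.LFunctions.WeilGroundState
import Literature.NumberTheory.LFunctions.AdversarialWeilPositivity
import HarnessLib

/-!
# Shifted-resolvent vectors of the truncated Weil form (operator-free encoding)

Sibling of `Literature/NumberTheory/LFunctions/WeilGroundState.lean` (same normalisation: additive
variable `t = log x`, test functions `IsWeilTest g`, `Q(g) = weilQuadratic g = W(g ⋆ g̃)`,
`ĝ(s) = weilMellin g s = ∫ g(t) e^{(s-1/2)t} dt` — so `ĝ(1/2) = ∫ g = ⟨g, 1⟩_{L²}` — and ground
energy `ε(a) = weilGroundEnergy a = inf {Re Q(g) : g test, tsupport g ⊆ [-a, a], ∫ |g|² = 1}`).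

## What is defined

* `weilResolventFunctional lam g = J_λ(g) := Re Q(g) − λ ∫ |g|² − 2 Re ĝ(1/2)`, the Dirichlet
  functional of the SHIFTED form `q_λ(g) = Re Q(g) − λ ‖g‖₂²` with datum the constant function `1`,
  and its infimum `weilResolventInf a lam` over the test functions on the window `[-a, a]`.
* `IsWeilResolventVector a lam v`: `v : ℝ → ℂ` is a SHIFTED-RESOLVENT VECTOR of Weil's quadratic
  form on the window `[-a, a]` at the shift `λ = lam`, encoded WITHOUT positing an operator:
  `v ∈ L²` and `v` is the `L²`-limit of a MINIMISING SEQUENCE of window test functions for `J_λ`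
  (test functions `gₙ`, `tsupport gₙ ⊆ [-a, a]`, `J_λ(gₙ) → m = inf J_λ`, `∫ |gₙ − v|² → 0`).

## The sources, and why the encoding is faithful (functional analysis, not asserted in Lean)

For `λ` below the bottom of the form the shifted form is the square of a norm on the window test
functions — M. Suzuki (2026), §1.2, eq. (1.9): "Choose `λ` such that `λ_a > λ`, and define
`T_a = T_{a,λ} := A_a − λI`. Since `T_a` is positive, `‖v‖²_{T_a} := ⟨T_a v, v⟩_{L²} =
Q_W^a(v) − λ ‖v‖²_{L²}` defines a norm on `C_c^∞(−a, a)`. Let `H(T_a)` denote the corresponding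
completion." — where `A_a` is the lower-bounded self-adjoint operator of the lower-bounded closed
form `Q_W^a`, `Q_W^a(f, f) = ⟨A_a f | f⟩` (Connes–Consani–Moscovici (2025) §3.1, Prop. 3.3 and
eq. (3.23); the Friedrichs extension of `D^* G_a D`, Suzuki Thm. 1.1), and `λ_a = inf spec A_a` is
the infimum of the Rayleigh quotient over `C_c^∞(−a, a)` (Suzuki Cor. 1.2), i.e.
`λ_a = ε(a) = weilGroundEnergy a` here. In these terms `J_λ(g) = ‖g‖²_T − 2 Re ⟨g, 1⟩_{L²}`; the
functional `g ↦ ⟨g, 1_{[-a,a]}⟩` is bounded on `H(T)` (`|⟨g, 1⟩| ≤ √(2a) ‖g‖₂ ≤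
√(2a/(ε(a)−λ)) ‖g‖_T`), so by the Riesz representation theorem it is `⟨g, v₀⟩_T` for a unique
`v₀ ∈ H(T)`, namely `v₀ = T⁻¹ 1 = (A_a − λ)⁻¹ 1_{[-a,a]}` — literally the construction of the
resolvent of the operator of a closed form (T. Kato (1966), VI §2.1, proof of Thm. 2.1: "by the
Riesz theorem there is a unique `u′ ∈ H_t` such that `(u, v) = (u′, v)_t`") — and
`J_λ(g) = ‖g − v₀‖²_T − ‖v₀‖²_T`. Hence `inf J_λ = −‖v₀‖²_T = −Re v̂₀(1/2)`, the minimising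
sequences are exactly the sequences of window test functions converging to `v₀` in `H(T)`, they
exist (`C_c^∞(−a, a)` is dense in its completion) and converge in `L²`
(`‖·‖₂ ≤ (ε(a) − λ)^{-1/2} ‖·‖_T`): for `λ < ε(a)`, `IsWeilResolventVector a λ v` says precisely
that `v = (A_a − λ)⁻¹ 1_{[-a,a]}` a.e. Like `IsWeilGroundState`, the predicate itself is purely
variational over the tree's `IsWeilTest`, `weilQuadratic`, `weilMellin`.

Junk values (documented): for `a ≤ 0` the only window test function is `0` and the predicate holds
iff `v = 0` a.e. (`isWeilResolventVector_iff_ae_eq_zero_of_nonpos`); for `λ` above the bottom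
`J_λ` is unbounded below on the window, no `m` exists and the predicate is empty. The route
statements using the notion quantify over `0 < a`, `λ < weilGroundEnergy a`.

PARSE WARNING (rev. 1 of this file). `J_λ` must be written `… - lam * (∫ t, ‖g t‖ ^ 2) - 2 * …`:
Lean's `∫ x, body` parses `body` at precedence 60, so WITHOUT the parentheses the binder captures
the trailing `- 2 * (weilMellin g (1 / 2)).re` and the expression denotes
`Re Q(g) − λ ∫ (|g|² − 2 Re ĝ(1/2))` (`weilResolventFunctional_ne_parse`, by `rfl`), whose
integrand is not even integrable when `Re ĝ(1/2) ≠ 0`. Rev. 0 of this file copied the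
unparenthesised text of route `RiemannHypothesis/ShiftedResolvent` (rev. 0) token for token and
therefore did NOT define the Dirichlet functional its docstrings describe; rev. 1 adds the
parentheses (`weilResolventFunctional_add_add` is the `ring`-checkable guard). Route items spelled
without the parentheses must be re-rendered before `isWeilResolventVector_iff` applies to them.

## API (all proved)

`isWeilResolventVector_iff` (the inline form of the route statements, `Iff.rfl`), `.memLp`,
`.bddBelow`, `eq_weilResolventInf_of_tendsto` / `.weilResolventInf_le` /
`.exists_tendsto_weilResolventInf` (the limit value `m` IS the infimum `weilResolventInf a lam`),
`.ae_eq_zero_of_notMem` (`v = 0` a.e. off `[-a, a]`), `.ae_eq_indicator`, `.integrableOn`,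
`.integrable`, `.integrable_mul_continuous`, `.integrable_mul_cexp`, `.hasDerivAt_weilMellin`,
`.differentiable_weilMellin` (`v̂` is entire), `.congr_ae`, and the junk case `a ≤ 0` (the
degenerate-support helpers `weilMellin_zero`, `IsWeilTest.eq_zero_of_tsupport_subset` are imported
from `AdversarialWeilPositivity.lean`). Existence and uniqueness a.e. for `λ < weilGroundEnergy a`
are NOT in this file.

## References

* M. Suzuki, *Weil's quadratic form via the screw function* (2026), arXiv:2606.09096, §1.2:
  Thm. 1.1, Cor. 1.2, eq. (1.9) (`T_{a,λ} = A_a − λ I`, the norm `‖·‖_{T_a}`, `H(T_a)`), Thm. 1.5.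
* A. Connes, C. Consani, H. Moscovici, *Zeta Spectral Triples* (2025), arXiv:2511.22755, §3.1:
  Prop. 3.3, Prop. 3.4, eq. (3.23) (the operator `A_λ` of the semilocal Weil form).
* T. Kato, *Perturbation theory for linear operators* (1966), VI §2.1 Thm. 2.1 (proof), §2.3.
* E. Bombieri, *Remarks on Weil's quadratic functional in the theory of prime numbers I*, Rend.
  Mat. Acc. Lincei (9) 11 (2000), §4 (the variational problems on `L²(E)`).
-/

noncomputable section

open Complex Filter Set MeasureTheory
open scoped Real Topology ENNReal ComplexConjugate

namespace Literature.NumberTheory.LFunctions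

/-! ## The definitions -/

/-- **The Dirichlet functional of the shifted Weil form**:
`J_λ(g) = Re Q(g) − λ ∫ |g|² − 2 Re ĝ(1/2)`, `ĝ(1/2) = ∫ g = ⟨g, 1⟩_{L²}`; on window test functions
and for `λ < ε(a)` this is `‖g‖²_T − 2 Re ⟨g, 1⟩` for Suzuki's norm `‖g‖²_T = Q_W^a(g) − λ‖g‖²`,
`T = T_{a,λ} = A_a − λ I` (Suzuki 2026 §1.2 eq. (1.9)), minimised over `H(T)` exactly at `T⁻¹ 1`.
[cite: Suzuki2026, §1.2 eq. (1.9)] -/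
def weilResolventFunctional (lam : ℝ) (g : ℝ → ℂ) : ℝ :=
  (weilQuadratic g).re - lam * (∫ t, ‖g t‖ ^ 2) - 2 * (weilMellin g (1 / 2)).re

/-- **Shifted-resolvent vector of the truncated Weil form, operator-free.**
`IsWeilResolventVector a lam v` says that `v : ℝ → ℂ` is square integrable and is the `L²`-limit
of a minimising sequence of test functions on the window `[-a, a]` for the Dirichlet functional
`J_λ(g) = Re Q(g) − λ ∫ |g|² − 2 Re ĝ(1/2)` (`weilResolventFunctional`, written out inline — mind
the parentheses around `∫ t, ‖h t‖ ^ 2`, see `isWeilResolventVector_iff`): there are smooth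
compactly supported `gₙ` with `tsupport gₙ ⊆ [-a, a]` and a real `m` with `m ≤ J_λ(h)`
for every test function `h` on the window, `J_λ(gₙ) → m`, and `∫ |gₙ − v|² → 0`. For
`λ < ε(a) = weilGroundEnergy a` this says `v = (A_a − λ)⁻¹ 1_{[-a,a]} = T_{a,λ}⁻¹ 1` a.e., the
Riesz representer of `g ↦ ⟨g, 1⟩_{L²}` in the completion `H(T_{a,λ})` of the window test functions
for Suzuki's norm `‖g‖²_T = Q_W^a(g) − λ‖g‖²` (Suzuki 2026 §1.2 eq. (1.9), `T_{a,λ} = A_a − λ I`;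
Kato VI §2.1, proof of Thm. 2.1; see the module docstring). Neither existence nor uniqueness is
part of the predicate; for `a ≤ 0` it degenerates to `v = 0` a.e.
[cite: Suzuki2026, §1.2 eq. (1.9) and Thm. 1.1, Cor. 1.2] -/
def IsWeilResolventVector (a lam : ℝ) (v : ℝ → ℂ) : Prop :=
  MemLp v 2 ∧ ∃ g : ℕ → ℝ → ℂ,
    (∀ n, IsWeilTest (g n) ∧ tsupport (g n) ⊆ Icc (-a) a) ∧
    (∃ m : ℝ, (∀ h : ℝ → ℂ, IsWeilTest h → tsupport h ⊆ Icc (-a) a →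
        m ≤ (weilQuadratic h).re - lam * (∫ t, ‖h t‖ ^ 2) - 2 * (weilMellin h (1 / 2)).re) ∧
      Tendsto (fun n ↦ (weilQuadratic (g n)).re - lam * (∫ t, ‖g n t‖ ^ 2) -
        2 * (weilMellin (g n) (1 / 2)).re) atTop (𝓝 m)) ∧
    Tendsto (fun n ↦ ∫ t, ‖g n t - v t‖ ^ 2) atTop (𝓝 0)

/-- **The bottom of the Dirichlet functional** on the window,
`weilResolventInf a lam = inf {J_λ(h) : h test, tsupport h ⊆ [-a, a]}` (a real `sInf`, junk value
`0` if the set is unbounded below; the set always contains `J_λ(0) = 0`). For `λ < ε(a)` it is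
`−‖(A_a − λ)⁻¹ 1‖²_T = −Re ⟨(A_a − λ)⁻¹ 1, 1⟩` (module docstring). [cite: Suzuki2026, §1.2 eq. (1.9)] -/
def weilResolventInf (a lam : ℝ) : ℝ :=
  sInf {x : ℝ | ∃ h : ℝ → ℂ, IsWeilTest h ∧ tsupport h ⊆ Icc (-a) a ∧
    x = weilResolventFunctional lam h}

/-- Unfolding: `IsWeilResolventVector a lam v` is the inline predicate `MemLp v 2 ∧ ∃ g, …`
WITH THE PARENTHESES `lam * (∫ t, ‖h t‖ ^ 2) - 2 * …`. Warning (parse): without them, as in the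
text of route `ShiftedResolvent` rev. 0, Lean's `∫ x, body` (body parsed at precedence 60)
captures the trailing `- 2 * (weilMellin h (1 / 2)).re` INTO the integrand
(`weilResolventFunctional_ne_parse` below), which is not the Dirichlet functional; such route
items must be re-rendered with the parentheses (or through this predicate) to say what their
docstrings say. [folklore] -/
theorem isWeilResolventVector_iff (a lam : ℝ) (v : ℝ → ℂ) :
    IsWeilResolventVector a lam v ↔
      MemLp v 2 ∧ ∃ g : ℕ → ℝ → ℂ,
        (∀ n, IsWeilTest (g n) ∧ tsupport (g n) ⊆ Icc (-a) a) ∧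
        (∃ m : ℝ, (∀ h : ℝ → ℂ, IsWeilTest h → tsupport h ⊆ Icc (-a) a →
            m ≤ (weilQuadratic h).re - lam * (∫ t, ‖h t‖ ^ 2) - 2 * (weilMellin h (1 / 2)).re) ∧
          Tendsto (fun n ↦ (weilQuadratic (g n)).re - lam * (∫ t, ‖g n t‖ ^ 2) -
            2 * (weilMellin (g n) (1 / 2)).re) atTop (𝓝 m)) ∧
        Tendsto (fun n ↦ ∫ t, ‖g n t - v t‖ ^ 2) atTop (𝓝 0) :=
  Iff.rfl

/-- **Parse check of the Dirichlet functional** (cf. `weilArchTerm_eq`): the three terms of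
`J_λ(g)` are `Re Q(g)`, `−λ ∫ |g|²` and `−2 Re ĝ(1/2)`; in particular the linear term is OUTSIDE
the integral, so that `J_λ(g) + λ ∫ |g|² + 2 Re ĝ(1/2) = Re Q(g)` by `ring`. [folklore] -/
theorem weilResolventFunctional_add_add (lam : ℝ) (g : ℝ → ℂ) :
    weilResolventFunctional lam g + lam * (∫ t, ‖g t‖ ^ 2) + 2 * (weilMellin g (1 / 2)).re =
      (weilQuadratic g).re := by
  unfold weilResolventFunctional
  ring

/-- **The parse trap, recorded**: WITHOUT parentheses the expression
`(weilQuadratic g).re - lam * ∫ t, ‖g t‖ ^ 2 - 2 * (weilMellin g (1 / 2)).re` denotes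
`Re Q(g) − λ ∫ (|g(t)|² − 2 Re ĝ(1/2)) dt` — the `∫` binder extends over the trailing difference —
and this is definitionally the parenthesisation shown on the right. (It is NOT
`weilResolventFunctional lam g`; for `Re ĝ(1/2) ≠ 0` the integrand is not integrable and the
Bochner integral is the junk value `0`.) [folklore] -/
theorem weilResolventFunctional_ne_parse (lam : ℝ) (g : ℝ → ℂ) :
    ((weilQuadratic g).re - lam * ∫ t, ‖g t‖ ^ 2 - 2 * (weilMellin g (1 / 2)).re) =
      (weilQuadratic g).re - lam * ∫ t, (‖g t‖ ^ 2 - 2 * (weilMellin g (1 / 2)).re) :=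
  rfl

/-- `J_λ(0) = 0`. [folklore] -/
theorem weilResolventFunctional_zero (lam : ℝ) : weilResolventFunctional lam 0 = 0 := by
  simp [weilResolventFunctional, weilQuadratic_zero, weilMellin_zero]

/-- The zero function is a test function on every window, so the set of values of `J_λ` on the
window is never empty and contains `0`. [folklore] -/
theorem isWeilTest_zero : IsWeilTest (0 : ℝ → ℂ) :=
  ⟨contDiff_const, HasCompactSupport.zero⟩

/-- `weilResolventInf a lam ≤ 0` (the value `J_λ(0) = 0` is attained on every window; for an
unbounded-below value set the `sInf` is the junk value `0`). [folklore] -/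
theorem weilResolventInf_nonpos (a lam : ℝ) : weilResolventInf a lam ≤ 0 := by
  have h0 : (0 : ℝ) ∈ {x : ℝ | ∃ h : ℝ → ℂ, IsWeilTest h ∧ tsupport h ⊆ Icc (-a) a ∧
      x = weilResolventFunctional lam h} :=
    ⟨0, isWeilTest_zero, by simp [tsupport_zero], (weilResolventFunctional_zero lam).symm⟩
  unfold weilResolventInf
  by_cases hb : BddBelow {x : ℝ | ∃ h : ℝ → ℂ, IsWeilTest h ∧ tsupport h ⊆ Icc (-a) a ∧
      x = weilResolventFunctional lam h}
  · exact csInf_le hb h0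
  · rw [Real.sInf_of_not_bddBelow hb]

/-- **A limit of values that is a lower bound is the infimum**: if window test functions `gₙ`
have `J_λ(gₙ) → m` and `m ≤ J_λ(h)` for every window test function `h`, then
`m = weilResolventInf a lam`. [folklore] -/
theorem eq_weilResolventInf_of_tendsto {a lam m : ℝ} {g : ℕ → ℝ → ℂ}
    (hg : ∀ n, IsWeilTest (g n) ∧ tsupport (g n) ⊆ Icc (-a) a)
    (hm : ∀ k : ℝ → ℂ, IsWeilTest k → tsupport k ⊆ Icc (-a) a → m ≤ weilResolventFunctional lam k)
    (hlim : Tendsto (fun n ↦ weilResolventFunctional lam (g n)) atTop (𝓝 m)) :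
    m = weilResolventInf a lam := by
  set S : Set ℝ := {x : ℝ | ∃ h : ℝ → ℂ, IsWeilTest h ∧ tsupport h ⊆ Icc (-a) a ∧
    x = weilResolventFunctional lam h} with hS
  have hlb : m ∈ lowerBounds S := by
    rintro x ⟨k, hk, hsupp, rfl⟩
    exact hm k hk hsupp
  have hmem : ∀ n, weilResolventFunctional lam (g n) ∈ S := fun n ↦ ⟨g n, (hg n).1, (hg n).2, rfl⟩
  have hglb : IsGLB S m := ⟨hlb, fun b hb ↦ ge_of_tendsto' hlim fun n ↦ hb (hmem n)⟩
  exact (hglb.csInf_eq ⟨_, hmem 0⟩).symm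

/-! ## `L²` limits of functions vanishing off a set -/

/-- If `u ∈ L²` is the `L²`-limit of square-integrable functions `gₙ` each vanishing off a
measurable set `S`, then `u = 0` a.e. off `S`:
`∫_{Sᶜ} |u|² = ∫_{Sᶜ} |gₙ − u|² ≤ ∫ |gₙ − u|² → 0`. [folklore] -/
theorem ae_eq_zero_of_tendsto_integral_norm_sq_sub {S : Set ℝ} (hS : MeasurableSet S)
    {u : ℝ → ℂ} (hu : MemLp u 2) {g : ℕ → ℝ → ℂ} (hgm : ∀ n, MemLp (g n) 2)
    (hg0 : ∀ n t, t ∉ S → g n t = 0)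
    (hlim : Tendsto (fun n ↦ ∫ t, ‖g n t - u t‖ ^ 2) atTop (𝓝 0)) :
    ∀ᵐ t : ℝ, t ∉ S → u t = 0 := by
  have hSc : MeasurableSet Sᶜ := hS.compl
  have hint : ∀ n, Integrable (fun t ↦ ‖g n t - u t‖ ^ 2) := fun n ↦ by
    have hm : MemLp (fun t ↦ g n t - u t) 2 := (hgm n).sub hu
    exact (memLp_two_iff_integrable_sq_norm hm.1).1 hm
  have hu2 : Integrable (fun t ↦ ‖u t‖ ^ 2) := (memLp_two_iff_integrable_sq_norm hu.1).1 hu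
  have hle : ∀ n, ∫ t in Sᶜ, ‖u t‖ ^ 2 ≤ ∫ t, ‖g n t - u t‖ ^ 2 := fun n ↦
    calc ∫ t in Sᶜ, ‖u t‖ ^ 2 = ∫ t in Sᶜ, ‖g n t - u t‖ ^ 2 := by
          refine setIntegral_congr_fun hSc fun t ht ↦ ?_
          simp only [hg0 n t ht, zero_sub, norm_neg]
      _ ≤ ∫ t, ‖g n t - u t‖ ^ 2 :=
          setIntegral_le_integral (hint n) (Eventually.of_forall fun t ↦ by positivity)
  have hz : ∫ t in Sᶜ, ‖u t‖ ^ 2 = 0 :=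
    le_antisymm (ge_of_tendsto' hlim hle) (integral_nonneg fun t ↦ by positivity)
  have hae : (fun t ↦ ‖u t‖ ^ 2) =ᵐ[volume.restrict Sᶜ] 0 :=
    (setIntegral_eq_zero_iff_of_nonneg_ae (Eventually.of_forall fun t ↦ by positivity)
      hu2.integrableOn).1 hz
  have hae' : ∀ᵐ t ∂(volume.restrict Sᶜ), u t = 0 :=
    hae.mono fun t ht ↦ by simpa using ht
  exact (ae_restrict_iff' hSc).1 hae'

/-! ## Entire Mellin transform of a window-supported integrable function -/

/-- `u · w` is integrable for `u` integrable on the window and a.e. zero off it, and `w`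
continuous. [folklore] -/
theorem integrable_mul_continuous_of_ae_eq_zero {a : ℝ} {u : ℝ → ℂ}
    (hint : IntegrableOn u (Icc (-a) a)) (hae : ∀ᵐ t : ℝ, t ∉ Icc (-a) a → u t = 0)
    {w : ℝ → ℂ} (hw : Continuous w) : Integrable fun t ↦ u t * w t :=
  (hint.mul_continuousOn hw.continuousOn isCompact_Icc).integrable_of_ae_notMem_eq_zero
    (hae.mono fun t ht hts ↦ by simp [ht hts])

/-- **`û` is entire** for `u` integrable on a window and a.e. zero off it, with
`û'(s) = ∫ u(t) t e^{(s-1/2)t} dt`: differentiation under the integral sign, dominated on the ball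
`‖s − s₀‖ < 1` by `|u(t)| |t| e^{(‖s₀‖+2)|t|}` (Bombieri 2000 §4, Lemma 4 and proof of Thm 3: "the
entire function `f̃_ν(s)`"). [cite: Bombieri2000Weil, §4 Lemma 4 and Thm 3 (proof)] -/
theorem hasDerivAt_weilMellin_of_ae_eq_zero {a : ℝ} {u : ℝ → ℂ}
    (hint : IntegrableOn u (Icc (-a) a)) (hae : ∀ᵐ t : ℝ, t ∉ Icc (-a) a → u t = 0) (s₀ : ℂ) :
    HasDerivAt (weilMellin u) (∫ t : ℝ, u t * (t * cexp ((s₀ - 1 / 2) * t))) s₀ := by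
  set A : ℝ := ‖s₀‖ + 2 with hA
  have hum : AEStronglyMeasurable u volume := (hint.integrable_of_ae_notMem_eq_zero hae).1
  have hF_meas : ∀ᶠ s in 𝓝 s₀,
      AEStronglyMeasurable (fun t : ℝ ↦ u t * cexp ((s - 1 / 2) * t)) volume :=
    Eventually.of_forall fun s ↦
      hum.mul (by fun_prop : Continuous fun t : ℝ ↦ cexp ((s - 1 / 2) * t)).aestronglyMeasurable
  have hF_int : Integrable (fun t : ℝ ↦ u t * cexp ((s₀ - 1 / 2) * t)) :=
    integrable_mul_continuous_of_ae_eq_zero hint hae (by fun_prop)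
  have hF'_meas :
      AEStronglyMeasurable (fun t : ℝ ↦ u t * (t * cexp ((s₀ - 1 / 2) * t))) volume :=
    hum.mul
      (by fun_prop : Continuous fun t : ℝ ↦ (t : ℂ) * cexp ((s₀ - 1 / 2) * t)).aestronglyMeasurable
  have h_bound : ∀ᵐ t : ℝ, ∀ s ∈ Metric.ball s₀ 1,
      ‖u t * (t * cexp ((s - 1 / 2) * t))‖ ≤ ‖u t‖ * (|t| * Real.exp (A * |t|)) := by
    refine Eventually.of_forall fun t s hs ↦ ?_
    rw [norm_mul, norm_mul, Complex.norm_exp, Complex.norm_real, Real.norm_eq_abs]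
    refine mul_le_mul_of_nonneg_left (mul_le_mul_of_nonneg_left (Real.exp_le_exp.2 ?_)
      (abs_nonneg _)) (norm_nonneg _)
    have hre : ((s - 1 / 2) * (t : ℂ)).re = (s.re - 1 / 2) * t := by simp [sub_re, mul_re]
    rw [hre]
    have hs' : ‖s - s₀‖ < 1 := by rwa [Metric.mem_ball, dist_eq_norm] at hs
    have h3 : |s.re - 1 / 2| ≤ A := by
      have e : s.re - 1 / 2 = (s - s₀).re + s₀.re + (-(1 / 2)) := by simp; ring
      rw [e, hA]
      refine (abs_add_three _ _ _).trans ?_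
      rw [abs_neg, abs_of_pos (by norm_num : (0 : ℝ) < 1 / 2)]
      linarith [abs_re_le_norm (s - s₀), abs_re_le_norm s₀]
    calc (s.re - 1 / 2) * t ≤ |(s.re - 1 / 2) * t| := le_abs_self _
      _ = |s.re - 1 / 2| * |t| := abs_mul _ _
      _ ≤ A * |t| := mul_le_mul_of_nonneg_right h3 (abs_nonneg _)
  have bound_integrable : Integrable fun t : ℝ ↦ ‖u t‖ * (|t| * Real.exp (A * |t|)) :=
    (IntegrableOn.mul_continuousOn hint.norm
      (by fun_prop : Continuous fun t : ℝ ↦ |t| * Real.exp (A * |t|)).continuousOn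
      isCompact_Icc).integrable_of_ae_notMem_eq_zero
        (hae.mono fun t ht hts ↦ by simp [ht hts])
  have h_diff : ∀ᵐ t : ℝ, ∀ s ∈ Metric.ball s₀ 1,
      HasDerivAt (fun s : ℂ ↦ u t * cexp ((s - 1 / 2) * t))
        (u t * (t * cexp ((s - 1 / 2) * t))) s :=
    Eventually.of_forall fun t s _ ↦ hasDerivAt_weilIntegrand u t s
  exact (hasDerivAt_integral_of_dominated_loc_of_deriv_le (Metric.ball_mem_nhds s₀ one_pos)
    hF_meas hF_int hF'_meas h_bound bound_integrable h_diff).2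

/-! ## API of `IsWeilResolventVector` -/

namespace IsWeilResolventVector

variable {a lam : ℝ} {v w : ℝ → ℂ}

/-- A shifted-resolvent vector is square integrable. [folklore] -/
theorem memLp (h : IsWeilResolventVector a lam v) : MemLp v 2 :=
  h.1

/-- The values of `J_λ` on the window test functions are bounded below (by `m`). [folklore] -/
theorem bddBelow (h : IsWeilResolventVector a lam v) :
    BddBelow {x : ℝ | ∃ h : ℝ → ℂ, IsWeilTest h ∧ tsupport h ⊆ Icc (-a) a ∧
      x = weilResolventFunctional lam h} := by
  obtain ⟨-, -, -, ⟨m, hm, -⟩, -⟩ := h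
  exact ⟨m, by rintro x ⟨k, hk, hsupp, rfl⟩; exact hm k hk hsupp⟩

/-- `weilResolventInf a lam ≤ J_λ(h)` for every test function `h` on the window, as soon as a
shifted-resolvent vector exists (so that the value set is bounded below). [folklore] -/
theorem weilResolventInf_le (h : IsWeilResolventVector a lam v) {k : ℝ → ℂ} (hk : IsWeilTest k)
    (hsupp : tsupport k ⊆ Icc (-a) a) : weilResolventInf a lam ≤ weilResolventFunctional lam k :=
  csInf_le h.bddBelow ⟨k, hk, hsupp, rfl⟩

/-- **Minimising sequence converging to `v`**, with the limit value identified: there are window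
test functions `gₙ` with `J_λ(gₙ) → weilResolventInf a lam` and `∫ |gₙ − v|² → 0`. [folklore] -/
theorem exists_tendsto_weilResolventInf (h : IsWeilResolventVector a lam v) :
    ∃ g : ℕ → ℝ → ℂ, (∀ n, IsWeilTest (g n) ∧ tsupport (g n) ⊆ Icc (-a) a) ∧
      Tendsto (fun n ↦ weilResolventFunctional lam (g n)) atTop (𝓝 (weilResolventInf a lam)) ∧
      Tendsto (fun n ↦ ∫ t, ‖g n t - v t‖ ^ 2) atTop (𝓝 0) := by
  obtain ⟨-, g, hg, ⟨m, hm, hJ⟩, hlim⟩ := h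
  obtain rfl : m = weilResolventInf a lam := eq_weilResolventInf_of_tendsto hg hm hJ
  exact ⟨g, hg, hJ, hlim⟩

/-- **Localisation**: a shifted-resolvent vector vanishes a.e. off the window `[-a, a]` (it is an
`L²`-limit of functions supported in the window; Suzuki 2026 §1.2: `L²(−a, a)` viewed in `L²(ℝ)`
"by extending functions to be zero outside `(−a, a)`"). [cite: Suzuki2026, §1.2] -/
theorem ae_eq_zero_of_notMem (h : IsWeilResolventVector a lam v) :
    ∀ᵐ t : ℝ, t ∉ Icc (-a) a → v t = 0 := by
  obtain ⟨hv, g, hg, -, hlim⟩ := h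
  exact ae_eq_zero_of_tendsto_integral_norm_sq_sub measurableSet_Icc hv
    (fun n ↦ (hg n).1.1.continuous.memLp_of_hasCompactSupport (hg n).1.2)
    (fun n t ht ↦ image_eq_zero_of_notMem_tsupport fun h' ↦ ht ((hg n).2 h')) hlim

/-- A shifted-resolvent vector agrees a.e. with its truncation to the window. [folklore] -/
theorem ae_eq_indicator (h : IsWeilResolventVector a lam v) :
    v =ᵐ[volume] (Icc (-a) a).indicator v := by
  filter_upwards [h.ae_eq_zero_of_notMem] with t ht
  by_cases hm : t ∈ Icc (-a) a
  · simp [hm]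
  · simp [hm, ht hm]

/-- A shifted-resolvent vector is integrable on its window (`L² ⊆ L¹` there). [folklore] -/
theorem integrableOn (h : IsWeilResolventVector a lam v) : IntegrableOn v (Icc (-a) a) :=
  (h.memLp.restrict (Icc (-a) a)).integrable one_le_two

/-- A shifted-resolvent vector is integrable on `ℝ`. [folklore] -/
theorem integrable (h : IsWeilResolventVector a lam v) : Integrable v :=
  h.integrableOn.integrable_of_ae_notMem_eq_zero h.ae_eq_zero_of_notMem

/-- `v · w` is integrable for every continuous `w`. [folklore] -/
theorem integrable_mul_continuous (h : IsWeilResolventVector a lam v) {w : ℝ → ℂ}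
    (hw : Continuous w) : Integrable fun t ↦ v t * w t :=
  integrable_mul_continuous_of_ae_eq_zero h.integrableOn h.ae_eq_zero_of_notMem hw

/-- **Exponential moments**: `t ↦ v(t) e^{ct}` is integrable for every `c : ℂ`. [folklore] -/
theorem integrable_mul_cexp (h : IsWeilResolventVector a lam v) (c : ℂ) :
    Integrable fun t : ℝ ↦ v t * cexp (c * t) :=
  h.integrable_mul_continuous (by fun_prop)

/-- `v̂` is complex differentiable everywhere, `v̂'(s) = ∫ v(t) t e^{(s-1/2)t} dt`. [folklore] -/
theorem hasDerivAt_weilMellin (h : IsWeilResolventVector a lam v) (s₀ : ℂ) :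
    HasDerivAt (weilMellin v) (∫ t : ℝ, v t * (t * cexp ((s₀ - 1 / 2) * t))) s₀ :=
  hasDerivAt_weilMellin_of_ae_eq_zero h.integrableOn h.ae_eq_zero_of_notMem s₀

/-- **The transform `v̂ = weilMellin v` of a shifted-resolvent vector is entire** (as are the
transforms `∫_{-a}^{a} v_±(a, x) e^{izx} dx` in Suzuki 2026 Thm. 1.5; here simply because `v` is
integrable and supported in the window). [folklore] -/
theorem differentiable_weilMellin (h : IsWeilResolventVector a lam v) :
    Differentiable ℂ (weilMellin v) :=
  fun s ↦ (h.hasDerivAt_weilMellin s).differentiableAt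

/-- **Invariance under modification on a null set.** [folklore] -/
theorem congr_ae (h : IsWeilResolventVector a lam v) (hvw : v =ᵐ[volume] w) :
    IsWeilResolventVector a lam w := by
  obtain ⟨hv, g, hg, hm, hlim⟩ := h
  refine ⟨hv.ae_eq hvw, g, hg, hm, ?_⟩
  have he : ∀ n, ∫ t, ‖g n t - w t‖ ^ 2 = ∫ t, ‖g n t - v t‖ ^ 2 := fun n ↦
    integral_congr_ae (hvw.mono fun t ht ↦ by simp [ht])
  simpa only [he] using hlim

end IsWeilResolventVector

/-- `IsWeilResolventVector a lam` is a property of the a.e.-class of `v`. [folklore] -/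
theorem isWeilResolventVector_congr_ae {a lam : ℝ} {v w : ℝ → ℂ} (hvw : v =ᵐ[volume] w) :
    IsWeilResolventVector a lam v ↔ IsWeilResolventVector a lam w :=
  ⟨fun h ↦ h.congr_ae hvw, fun h ↦ h.congr_ae hvw.symm⟩

/-- **The degenerate window (junk case, documented)**: for `a ≤ 0` the only window test function
is `0` (`IsWeilTest.eq_zero_of_tsupport_subset`), `J_λ(0) = 0`, and
`IsWeilResolventVector a lam v ↔ v = 0` a.e. [folklore] -/
theorem isWeilResolventVector_iff_ae_eq_zero_of_nonpos {a : ℝ} (ha : a ≤ 0) (lam : ℝ)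
    (v : ℝ → ℂ) : IsWeilResolventVector a lam v ↔ v =ᵐ[volume] 0 := by
  constructor
  · rintro ⟨hv, g, hg, -, hlim⟩
    have hg0 : ∀ n, g n = 0 := fun n ↦
      (hg n).1.eq_zero_of_tsupport_subset (hg n).2 ha
    have hconst : ∀ n, ∫ t, ‖g n t - v t‖ ^ 2 = ∫ t, ‖v t‖ ^ 2 := fun n ↦ by
      simp [hg0 n]
    simp only [hconst, tendsto_const_nhds_iff] at hlim
    have hv2 : Integrable (fun t ↦ ‖v t‖ ^ 2) := (memLp_two_iff_integrable_sq_norm hv.1).1 hv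
    have hae : (fun t ↦ ‖v t‖ ^ 2) =ᵐ[volume] 0 :=
      (integral_eq_zero_iff_of_nonneg (fun t ↦ by positivity) hv2).1 hlim
    exact hae.mono fun t ht ↦ by simpa using ht
  · intro hv
    have hv2 : MemLp v 2 := MemLp.zero.ae_eq hv.symm
    refine ⟨hv2, fun _ ↦ 0, fun _ ↦ ⟨isWeilTest_zero, by simp [tsupport_zero]⟩, ⟨0, ?_, ?_⟩, ?_⟩
    · intro k hk hsupp
      rw [hk.eq_zero_of_tsupport_subset hsupp ha]
      exact (weilResolventFunctional_zero lam).ge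
    · exact tendsto_const_nhds.congr fun n ↦ (weilResolventFunctional_zero lam).symm
    · have he : ∫ t, ‖(0 : ℝ → ℂ) t - v t‖ ^ 2 = 0 := by
        rw [integral_congr_ae (g := fun _ ↦ (0 : ℝ)) (hv.mono fun t ht ↦ by simp [ht])]
        simp
      simp only [he]
      exact tendsto_const_nhds

end Literature.NumberTheory.LFunctions

end
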